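import Mathlib.Algebra.Order.Archimedean.Basic
import Literature.AnabelianGeometry.EtaleTheta.DivisorMonoids
import Literature.AnabelianGeometry.EtaleTheta.FrdIVocabulary
import Literature.AnabelianGeometry.EtaleTheta.MonoprimeStructure

/-!
# [EtTh] Remark 3.5.1: perf-factorial group-saturated submonoids of an `ℝ`-monoprime monoid — proof

Source: S. Mochizuki, *The étale theta function and its Frobenioid-theoretic manifestations*,
Publ. RIMS **45** (2009) [MochizukiEtTh2009], Remark 3.5.1, PDF p. 76 (printed 302): "Observe that it
follows immediately from Lemma 3.5, (i), that a nonzero submonoid `P` of an `ℝ`-monoprime [cf. [FrdI],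
§0] monoid `Q` is perf-factorial and group-saturated if and only if it is monoprime."

The §3 statement file records this as the named fact `Remark351 V` over the [FrdI]-vocabulary stub `V`
(`DivisorMonoids.lean`, seat abc-iut-L2-t3); instantiated with the tree's vocabulary `treeMonoidVocab`
(`FrdIVocabulary.lean`) it is a closed statement, DISCHARGED here (`Remark351_holds`):

* "only if": `Q ≅ ℝ_{≥0}` is archimedean and `P` is group-saturated in `Q`, so any two non-units of `P`
  are `≼`-equivalent; hence `P` has a single prime `𝔭` with `P_𝔭 = P`, which is monoprime by
  [FrdI] Def. 2.4 (i)(b) (`precsim_of_isGroupSaturated`);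
* "if": a monoprime monoid is perf-factorial (`MonoprimeStructure.isPerfFactorial`), and a monoprime
  `P ⊆ Q ≅ ℝ_{≥0}` is group-saturated because `P ↪ ℝ_{≥0}` reflects `≤`
  (`MonoprimeStructure.dvd_of_hom_le`).

(The printed route via Lemma 3.5 (i) is replaced by this direct argument; Lemma 3.5 itself is
`Discharge/Sec3Lemma35Rlf.lean`.) Proof-only (no definitions). Seat abc-iut-L2-d2 (cell abc-iut, node
EtTh:Rmk3.5.1).
-/

namespace Literature.AnabelianGeometry.EtaleTheta

open Literature.AlgebraicGeometry.Frobenioids NNReal Function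

universe w

variable {Q : Type w} [CommMonoid Q]

/-- A group-saturated submonoid `P` of an `ℝ`-monoprime monoid `Q` is archimedean for `≼`: for
`a, b ∈ P` with `b ≠ 0`, `a ≤ n · b` in `Q ≅ ℝ_{≥0}` for large `n` and the difference `n · b - a ∈ Q`
lies in `P` by group-saturation ([EtTh] Rmk 3.5.1, "only if"). [cite: MochizukiEtTh2009, Rmk 3.5.1 p.76] -/
theorem precsim_of_isGroupSaturated (hQ : IsRMonoprime Q) (P : Submonoid Q) (hsat : IsGroupSaturated P)
    {a b : P} (hb : b ≠ 1) : a ≼ b := by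
  obtain ⟨⟨eQ⟩⟩ := hQ
  have hgb : Multiplicative.toAdd (eQ (b : Q)) ≠ 0 := by
    intro h0
    apply hb
    apply Subtype.ext
    apply eQ.injective
    apply Multiplicative.toAdd.injective
    rw [h0, OneMemClass.coe_one, map_one, toAdd_one]
  obtain ⟨n, hn⟩ := exists_nat_ge (Multiplicative.toAdd (eQ (a : Q)) / Multiplicative.toAdd (eQ (b : Q)))
  have hle : Multiplicative.toAdd (eQ (a : Q)) ≤ ((n + 1 : ℕ) : ℝ≥0) * Multiplicative.toAdd (eQ (b : Q)) := by
    have h1 : Multiplicative.toAdd (eQ (a : Q)) ≤ (n : ℝ≥0) * Multiplicative.toAdd (eQ (b : Q)) := by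
      rwa [div_le_iff₀ (pos_iff_ne_zero.mpr hgb)] at hn
    refine h1.trans ?_
    gcongr
    exact_mod_cast Nat.le_succ n
  obtain ⟨t, ht⟩ := exists_add_of_le hle
  -- the element `q := (n+1)·b - a` of `Q`
  let q : Q := eQ.symm (Multiplicative.ofAdd t)
  have hq : q * (a : Q) = (b : Q) ^ (n + 1) := by
    apply eQ.injective
    apply Multiplicative.toAdd.injective
    rw [map_mul, toAdd_mul, MulEquiv.apply_symm_apply, toAdd_ofAdd, map_pow, toAdd_pow, nsmul_eq_mul,
      ht, add_comm]
  rw [isGroupSaturated_iff'] at hsat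
  have hqP : q ∈ P := hsat q _ (P.pow_mem b.2 (n + 1)) _ a.2 hq
  refine ⟨n + 1, Nat.succ_pos n, ⟨⟨q, hqP⟩, Subtype.ext ?_⟩⟩
  rw [SubmonoidClass.coe_pow, Submonoid.coe_mul, ← hq, mul_comm]

/-- **[EtTh] Remark 3.5.1** (p. 76), DISCHARGED for the tree's [FrdI] vocabulary: "a nonzero submonoid `P`
of an `ℝ`-monoprime monoid `Q` is perf-factorial and group-saturated if and only if it is monoprime."
[cite: MochizukiEtTh2009, Rmk 3.5.1 p.76] -/
theorem Remark351_holds : Remark351 treeMonoidVocab.{w} := by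
  intro Q _ P hQ hP0
  show IsPerfFactorial ↥P ∧ IsGroupSaturated P ↔ IsMonoprime ↥P
  constructor
  · rintro ⟨hpf, hsat⟩
    have harch : ∀ a b : P, b ≠ 1 → a ≼ b := fun _ _ hb => precsim_of_isGroupSaturated hQ P hsat hb
    -- a non-unit of `P`
    have hne : ¬ ∀ x ∈ P, x = (1 : Q) := fun h => hP0 ((Submonoid.eq_bot_iff_forall P).mpr h)
    obtain ⟨x, hx⟩ := not_forall.mp hne
    obtain ⟨hxP, hx1⟩ := Classical.not_imp.mp hx
    have hε : (⟨x, hxP⟩ : P) ≠ 1 := fun h => hx1 (congrArg Subtype.val h)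
    obtain ⟨𝔭⟩ := MonoprimeStructure.primes_nonempty harch hε
    obtain ⟨e⟩ := MonoprimeStructure.nonempty_submonoid_mulEquiv harch 𝔭
    exact PerfectionPrimes.isMonoprime_of_mulEquiv e (hpf.isMonoprime 𝔭)
  · intro hmono
    refine ⟨MonoprimeStructure.isPerfFactorial hmono, ?_⟩
    rw [isGroupSaturated_iff']
    intro q a ha b hb hqba
    obtain ⟨⟨eQ⟩⟩ := hQ
    let g : ↥P →* Multiplicative ℝ≥0 := eQ.toMonoidHom.comp P.subtype
    have hg : Injective g := eQ.injective.comp Subtype.val_injective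
    have hle : Multiplicative.toAdd (g ⟨b, hb⟩) ≤ Multiplicative.toAdd (g ⟨a, ha⟩) := by
      show Multiplicative.toAdd (eQ b) ≤ Multiplicative.toAdd (eQ a)
      rw [← hqba, map_mul, toAdd_mul]
      exact le_add_self
    obtain ⟨d, hd⟩ := MonoprimeStructure.dvd_of_hom_le hmono g hg hle
    have hd' : a = b * (d : Q) := congrArg Subtype.val hd
    have hqd : q = (d : Q) := by
      apply eQ.injective
      apply Multiplicative.toAdd.injective
      have := congrArg (fun z => Multiplicative.toAdd (eQ z)) (hqba.trans hd')
      simp only [map_mul, toAdd_mul] at this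
      rw [add_comm] at this
      exact add_left_cancel this
    rw [hqd]
    exact d.2

end Literature.AnabelianGeometry.EtaleTheta
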